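import Mathlib
import Literature.Computability.AlgebraicComplexity.StandardFamilies
import Summits.ValiantsHypothesis.ValiantsHypothesis.Theses.ElementaryWordLength

/-!
# Ideator1Sketch — crux WordPerSuperQuartic (stmt-ValiantsHypothesis-6624), ideator 1, round 1

First lemmas of the two crux idea cards `imm-packing-product-tax` and `maurer-cartan-costate`.
Everything is stated over the route's INLINE word predicate (letters `(i, j, λ, Option σ)` ↦
`Matrix.transvection i j (C λ * (1 | X v))`). Statements only (`sorry` in proofs is deliberate:
crux-ideate files signatures, crux-plan files skeletons).
-/

set_option linter.dupNamespace false

namespace Summit.ValiantsHypothesis.ValiantsHypothesis.Cruxes.WordPerSuperQuartic.Sketch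

open Literature.Computability.AlgebraicComplexity MvPolynomial

noncomputable section

/-- A letter of an elementary word over the variable set `σ`: `(i, j, λ, none)` is the constant
letter `E_ij(λ)`, `(i, j, λ, some v)` the variable letter `E_ij(λ·x_v)`. -/
abbrev Letter (σ : Type) := Fin 3 × Fin 3 × ℂ × Option σ

/-- The matrix of a letter (verbatim the route's inline term). -/
def letterMat {σ : Type} (l : Letter σ) : Matrix (Fin 3) (Fin 3) (MvPolynomial σ ℂ) :=
  Matrix.transvection l.1 l.2.1 (C l.2.2.1 * l.2.2.2.elim 1 X)

/-- Product of a word. -/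
def wordProd {σ : Type} (w : List (Letter σ)) : Matrix (Fin 3) (Fin 3) (MvPolynomial σ ℂ) :=
  (w.map letterMat).prod

/-- `w` is an affine elementary word for the transvection `E_13(f)` (route's predicate). -/
def IsWordFor {σ : Type} (w : List (Letter σ)) (f : MvPolynomial σ ℂ) : Prop :=
  (∀ l ∈ w, l.1 ≠ l.2.1) ∧ wordProd w = Matrix.transvection (0 : Fin 3) 2 f

/-- Number of VARIABLE letters of a word (constant letters are free in the `ν` measure; every
lower bound on `varLen` is a lower bound on `List.length`). -/
def varLen {σ : Type} (w : List (Letter σ)) : ℕ := (w.filter fun l => l.2.2.2.isSome).length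

theorem varLen_le_length {σ : Type} (w : List (Letter σ)) : varLen w ≤ w.length :=
  List.length_filter_le _ _

/-! ## Card `imm-packing-product-tax` -/

/-- **C⁺ (transfer target).** Super-cubic variable-length for elementary words of the
constant-width iterated matrix product `IMM_{k,d} = tr(X⁽⁰⁾⋯X⁽ᵈ⁻¹⁾)` (`k × k` matrices, `d` of
them): for some `ε > 0` and all large `d`, every word for `E_13(IMM_{k,d})` has at least
`d^(3+ε)` variable letters. Upper bounds: `d^(2 + log₂ k)` by Ben-Or–Cleve divide and conquer
(`[E_12(f), E_23(g)] = E_13(fg)`), improved to `d^(log₂(3.46 k))` by the dirty-slot calculus of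
`ShortWords.lean` (central garbage commutes away: `E_13(x₁x₂x₃)` in 8 letters), so the statement
is false for `k = 2`, has a window `(3, 3.38]` at `k = 3` and `(3, 3.79]` at `k = 4`; the card
recommends `k ≥ 4`. -/
def IMMWordSuperCubic (k : ℕ) : Prop :=
  ∃ ε : ℝ, 0 < ε ∧ ∃ d₀ : ℕ, ∀ d ≥ d₀, ∀ w : List (Letter (Fin d × Fin k × Fin k)),
    IsWordFor w (immPoly k d ℂ) → (d : ℝ) ^ (3 + ε) ≤ varLen w

/-- **Sparse embedding (support).** `IMM_{k,d}` is a `0/1`-substitution instance of `per_N` with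
`N ≤ c·k·d` using at most `c·k²·d` VARIABLE positions (the universal path-to-cycle-cover
embedding of a width-`k`, length-`d` ABP into a permanent; Valiant 1979 / Bürgisser 2000 §2). -/
def ImmSparseInPer (k c : ℕ) : Prop :=
  ∀ d : ℕ, 1 ≤ d → ∃ N : ℕ, N ≤ c * k * d ∧
    ∃ a : Fin N × Fin N → (Fin d × Fin k × Fin k) ⊕ ℂ,
      (Finset.univ.filter fun p => (a p).isLeft = true).card ≤ c * k * k * d ∧
      aeval (fun p => Sum.elim X C (a p)) (perPoly (Fin N) ℂ) = immPoly k d ℂ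

/-- **First lemma (packing / orbit averaging).** If `g` is obtained from `per_N` by substituting
variables of `g` at the positions of a pattern `G` and constants elsewhere, and every word for
`E_13(g)` has `≥ Λ` variable letters, then every word for `E_13(per_N)` has
`≥ (N²/|G|)·Λ` variable letters: average, over the `S_N × S_N`-orbit of the pattern, the number of
letters of `w` sitting at pattern positions (each restricted, relabelled word is a word for
`E_13(g)`; every position lies in the same number of translates). -/
theorem packing {N : ℕ} {τ : Type} (g : MvPolynomial τ ℂ) (a : Fin N × Fin N → τ ⊕ ℂ)
    (ha : aeval (fun p => Sum.elim X C (a p)) (perPoly (Fin N) ℂ) = g) (Λ : ℕ)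
    (hg : ∀ w : List (Letter τ), IsWordFor w g → Λ ≤ varLen w)
    (w : List (Letter (Fin N × Fin N))) (hw : IsWordFor w (perPoly (Fin N) ℂ)) :
    N * N * Λ ≤ (Finset.univ.filter fun p => (a p).isLeft = true).card * varLen w := by
  sorry

/-- **Composition (checked): C⁺ + sparse embedding ⇒ the crux, by name.** (`per_m` is the
restriction of `per_n`, `m ≤ n`, to a diagonal block, so all large `n` are covered.) -/
theorem wordPerSuperQuartic_of_imm (k c : ℕ) (hk : 3 ≤ k) (h₁ : IMMWordSuperCubic k)
    (h₂ : ImmSparseInPer k c) :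
    Summit.ValiantsHypothesis.ValiantsHypothesis.Theses.ElementaryWordLength.WordPerSuperQuartic := by
  sorry

/-- **Product tax (the engine C⁺ reduces to), one matrix-product layer.** For variable-disjoint
blocks, `ν(E_13(∑_{l<k} f_l g_l)) ≥ c · min_l (ν(f_l) + ν(g_l))`; known words give `c ≤ 3.46k`
(Ben-Or–Cleve: `4k`); `IMMWordSuperCubic k` follows from any `c > 8` by induction on `d`
(`IMM_{k,2d}` restricts to `∑_l A_{1l} B_{l1}` with `A`, `B` independent copies of `IMM_{k,d}`).
Stated here for two generic-entry products (`k` summands of products of two disjoint copies). -/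
def ProductTax (k : ℕ) (c : ℝ) : Prop :=
  ∀ d : ℕ, 1 ≤ d → ∀ Λ : ℕ,
    (∀ w : List (Letter (Fin d × Fin k × Fin k)), IsWordFor w (immPoly k d ℂ) → Λ ≤ varLen w) →
    ∀ w : List (Letter (Fin (2 * d) × Fin k × Fin k)), IsWordFor w (immPoly k (2 * d) ℂ) →
      c * Λ ≤ varLen w

theorem immWordSuperCubic_of_productTax (k : ℕ) (c : ℝ) (hc : 8 < c) (h : ProductTax k c)
    (h0 : ∀ w : List (Letter (Fin 1 × Fin k × Fin k)), IsWordFor w (immPoly k 1 ℂ) → 1 ≤ varLen w) :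
    IMMWordSuperCubic k := by
  sorry

/-! ## Card `maurer-cartan-costate` -/

/-- **First lemma (Maurer–Cartan / costate identity).** For a word `w` with product `E_13(f)`
and prefix products `Q_r` (first `r` letters), the logarithmic derivative `dW·W⁻¹ = df·e₁₃`
unfolds to: for every variable `v`,
`∂_v f = ∑_{r : letter r reads v} λ_r · (Q_r)_{0,i_r} · (Q_r⁻¹)_{j_r,2}`, and `Q_r⁻¹ = adj Q_r`
(determinant one). Equivalently `∂_v f = ∑ λ_r tr(Z_r e_{i_r j_r})` with the COSTATE
`Z_r = Q_r⁻¹ e₃₁ Q_r` on the minimal nilpotent orbit. -/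
theorem maurerCartan {σ : Type} [DecidableEq σ] (w : List (Letter σ)) (f : MvPolynomial σ ℂ)
    (hw : IsWordFor w f) (v : σ) :
    pderiv v f = ∑ r : Fin w.length,
      (if (w.get r).2.2.2 = some v then
        C (w.get r).2.2.1 * (wordProd (w.take r)) 0 (w.get r).1 *
          (wordProd (w.take r)).adjugate (w.get r).2.1 2
      else 0) := by
  sorry

/-- **Corollary (two reads).** A variable whose partial derivative of `f` is not a constant is
read at least twice (one read would make a column of an `SL₃(ℂ[x])`-matrix a non-unit multiple of
`e₁`). Gives `ν(per_n) ≥ 2n²` and, with the costate ordering argument, the `2d` floor for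
monomials `x₁⋯x_d`. -/
theorem two_reads {σ : Type} [DecidableEq σ] (w : List (Letter σ)) (f : MvPolynomial σ ℂ)
    (hw : IsWordFor w f) (v : σ) (hv : ∀ c : ℂ, pderiv v f ≠ C c) :
    2 ≤ (w.filter fun l => l.2.2.2 = some v).length := by
  sorry

/-- **Degree-one cancellation (BCH, first order).** If `f` has no monomial of degree `≤ 1`
involving `v` alone... stated for `f` with vanishing linear part: the letters reading `v`,
transported by the constant parts of their prefixes, cancel in `sl₃(ℂ)`:
`∑_{r reads v} λ_r · g_r e_{i_r j_r} g_r⁻¹ = 0`, `g_r :=` product of the constant parts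
(`x ↦ 0`) of the first `r` letters. -/
theorem firstOrder_cancel {σ : Type} [DecidableEq σ] (w : List (Letter σ)) (f : MvPolynomial σ ℂ)
    (hw : IsWordFor w f) (v : σ) (hlin : MvPolynomial.coeff 0 (pderiv v f) = 0) :
    (∑ r : Fin w.length,
      (if (w.get r).2.2.2 = some v then
        (w.get r).2.2.1 •
          ((wordProd (w.take r)).map (MvPolynomial.coeff 0) *
            Matrix.single (w.get r).1 (w.get r).2.1 (1 : ℂ) *
            ((wordProd (w.take r)).map (MvPolynomial.coeff 0)).adjugate)
      else 0)) = 0 := by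
  sorry

end

end Summit.ValiantsHypothesis.ValiantsHypothesis.Cruxes.WordPerSuperQuartic.Sketch
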